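import Mathlib
import HarnessLib

/-!
# Two rows determine an `SU(3)` matrix: the third row is the conjugate cross product of the first two, and conversely `[u; v; conj(u × v)] ∈ SU(3)` for every orthonormal pair — the 12-real-number link format

HONEST FRAMING: exact (Metropolis-corrected) sampling algorithms for lattice gauge theory;
figures of merit are autocorrelation/cost numbers at stated couplings and volumes; no
continuum-physics claim.

Venture `LatticeQCDFlow` (cell pub-lqcd), sub-topic `Scoring`; FANOUT row 21 (`su3-base`: the 4D
`SU(3)` baselines).  NEW WORK of the cell (placement rule), Mathlib-only (`Matrix.adjugate_fin_three`, the cross product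
`⨯₃` of `Mathlib.LinearAlgebra.CrossProduct`), elementary; no definition is introduced; nothing is
cited as a fact; no number of ours.  (The step `adj U = U†` on `SU(n)` is row 21 GEN-8's
`Scoring/SU3CayleyHamilton.adjugate_eq_star_of_mem_specialUnitaryGroup`; it is re-derived inline
here in three lines so that this file does not wait for that module's build.)  Printed counterpart NAMED ONLY: the
two-row ("12-parameter") storage / reconstruction of `SU(3)` link variables used by GPU lattice codes
(Clark–Babich–Barros–Brower–Rebbi, Comput. Phys. Commun. 181 (2010) 1517, §3.3), and the older
"reconstruct the third row" trick of CPU codes.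

For `U ∈ SU(3)` the adjugate is the conjugate transpose, `adj U = U†`.  Column `2` of the adjugate
of ANY `3 × 3` matrix is the cross product of rows `0` and `1` (its entries are the corresponding
cofactors), so `conj(U₂ⱼ) = (U₀ × U₁)ⱼ`: **the third row of an `SU(3)` matrix is the complex
conjugate of the cross product of the first two** (and cyclically).  Hence two rows — `12` real
numbers instead of `18` — determine the link, and conversely for EVERY Hermitian-orthonormal pair
`u, v ∈ ℂ³` the reconstructed matrix `[u; v; conj(u × v)]` IS special unitary: its rows are
orthonormal (`u·(u×v) = v·(u×v) = 0`, `|u × v|² = |u|²|v|² − |⟨u,v⟩|² = 1` by Lagrange's identity)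
and its determinant is `conj(u×v)·(u×v) = 1`.

## What is proved

* §1 (any commutative ring) `adjugate_col_two_eq_cross`, `adjugate_col_zero_eq_cross`,
  `adjugate_col_one_eq_cross` — the columns of `adj A` are `A₁ × A₂`, `A₂ × A₀`, `A₀ × A₁`;
  `star_cross` (conjugation commutes with `×₃` over `ℂ`).
* §2 (`SU(3)`) **`su3_row_two_eq_star_cross`** (`U 2 = conj(U 0 × U 1)`), `su3_row_zero_eq_star_cross`,
  `su3_row_one_eq_star_cross`; **`su3_eq_of_two_rows_eq`** — two `SU(3)` matrices with the same
  first two rows are equal (the two-row format is lossless).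
* §3 (reconstruction) **`reconstruct_mem_specialUnitaryGroup`** — for `u, v : Fin 3 → ℂ` with
  `u ⬝ conj u = 1`, `v ⬝ conj v = 1`, `u ⬝ conj v = 0`, the matrix with rows `u, v, conj(u × v)` lies
  in `SU(3)`; `reconstruct_rows` (its first two rows are `u, v`).

NOT CLAIMED: anything about floating-point error of the reconstruction (the codes' motivation) or
about the 8-parameter formats; anything for `N ≠ 3`.
-/

namespace Summit.Ventures.LatticeQCDFlow.Scoring

open Matrix

/-! ## §1 Columns of the `3 × 3` adjugate are cross products of rows -/

section AnyRing

variable {R : Type*} [CommRing R]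

/-- Column `2` of `adj A` is the cross product of rows `0` and `1`. -/
theorem adjugate_col_two_eq_cross (A : Matrix (Fin 3) (Fin 3) R) :
    (fun j => adjugate A j 2) = A 0 ⨯₃ A 1 := by
  rw [adjugate_fin_three, cross_apply]
  funext j
  fin_cases j <;> simp [neg_add_eq_sub, mul_comm]

/-- Column `0` of `adj A` is the cross product of rows `1` and `2`. -/
theorem adjugate_col_zero_eq_cross (A : Matrix (Fin 3) (Fin 3) R) :
    (fun j => adjugate A j 0) = A 1 ⨯₃ A 2 := by
  rw [adjugate_fin_three, cross_apply]
  funext j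
  fin_cases j <;> simp [neg_add_eq_sub, mul_comm]

/-- Column `1` of `adj A` is the cross product of rows `2` and `0`. -/
theorem adjugate_col_one_eq_cross (A : Matrix (Fin 3) (Fin 3) R) :
    (fun j => adjugate A j 1) = A 2 ⨯₃ A 0 := by
  rw [adjugate_fin_three, cross_apply]
  funext j
  fin_cases j <;> simp [neg_add_eq_sub, mul_comm]

end AnyRing

/-- Complex conjugation (entrywise `star`) commutes with the cross product. -/
theorem star_cross (u v : Fin 3 → ℂ) : star (u ⨯₃ v) = star u ⨯₃ star v := by
  rw [cross_apply, cross_apply]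
  funext j
  fin_cases j <;> simp [Pi.star_apply]

/-! ## §2 `SU(3)`: each row is the conjugate cross product of the other two -/

section SpecialUnitaryThree

/-- **The third row of an `SU(3)` matrix is the conjugate cross product of the first two**:
`U 2 = conj (U 0 × U 1)`. -/
theorem su3_row_two_eq_star_cross {U : Matrix (Fin 3) (Fin 3) ℂ}
    (hU : U ∈ Matrix.specialUnitaryGroup (Fin 3) ℂ) : U 2 = star (U 0 ⨯₃ U 1) := by
  have hadj : adjugate U = star U := by
    have h1 : U * adjugate U = 1 := by
      rw [mul_adjugate, (Matrix.mem_specialUnitaryGroup_iff.mp hU).2, one_smul]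
    calc adjugate U = (star U * U) * adjugate U := by
          rw [Unitary.star_mul_self_of_mem (Matrix.mem_specialUnitaryGroup_iff.mp hU).1, Matrix.one_mul]
      _ = star U := by rw [Matrix.mul_assoc, h1, Matrix.mul_one]
  have hcol := adjugate_col_two_eq_cross U
  rw [hadj] at hcol
  -- `hcol : (fun j => (star U) j 2) = U 0 × U 1`, and `(star U) j 2 = conj (U 2 j)`
  have h : star (U 2) = U 0 ⨯₃ U 1 := by
    rw [← hcol]
    funext j
    simp [Matrix.star_apply]
  rw [← h, star_star]

/-- Cyclically: `U 0 = conj (U 1 × U 2)`. -/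
theorem su3_row_zero_eq_star_cross {U : Matrix (Fin 3) (Fin 3) ℂ}
    (hU : U ∈ Matrix.specialUnitaryGroup (Fin 3) ℂ) : U 0 = star (U 1 ⨯₃ U 2) := by
  have hadj : adjugate U = star U := by
    have h1 : U * adjugate U = 1 := by
      rw [mul_adjugate, (Matrix.mem_specialUnitaryGroup_iff.mp hU).2, one_smul]
    calc adjugate U = (star U * U) * adjugate U := by
          rw [Unitary.star_mul_self_of_mem (Matrix.mem_specialUnitaryGroup_iff.mp hU).1, Matrix.one_mul]
      _ = star U := by rw [Matrix.mul_assoc, h1, Matrix.mul_one]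
  have hcol := adjugate_col_zero_eq_cross U
  rw [hadj] at hcol
  have h : star (U 0) = U 1 ⨯₃ U 2 := by
    rw [← hcol]
    funext j
    simp [Matrix.star_apply]
  rw [← h, star_star]

/-- Cyclically: `U 1 = conj (U 2 × U 0)`. -/
theorem su3_row_one_eq_star_cross {U : Matrix (Fin 3) (Fin 3) ℂ}
    (hU : U ∈ Matrix.specialUnitaryGroup (Fin 3) ℂ) : U 1 = star (U 2 ⨯₃ U 0) := by
  have hadj : adjugate U = star U := by
    have h1 : U * adjugate U = 1 := by
      rw [mul_adjugate, (Matrix.mem_specialUnitaryGroup_iff.mp hU).2, one_smul]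
    calc adjugate U = (star U * U) * adjugate U := by
          rw [Unitary.star_mul_self_of_mem (Matrix.mem_specialUnitaryGroup_iff.mp hU).1, Matrix.one_mul]
      _ = star U := by rw [Matrix.mul_assoc, h1, Matrix.mul_one]
  have hcol := adjugate_col_one_eq_cross U
  rw [hadj] at hcol
  have h : star (U 1) = U 2 ⨯₃ U 0 := by
    rw [← hcol]
    funext j
    simp [Matrix.star_apply]
  rw [← h, star_star]

/-- **The two-row format is lossless**: two `SU(3)` matrices with the same rows `0` and `1` are
equal. -/
theorem su3_eq_of_two_rows_eq {U V : Matrix (Fin 3) (Fin 3) ℂ}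
    (hU : U ∈ Matrix.specialUnitaryGroup (Fin 3) ℂ) (hV : V ∈ Matrix.specialUnitaryGroup (Fin 3) ℂ)
    (h0 : U 0 = V 0) (h1 : U 1 = V 1) : U = V := by
  ext i j
  fin_cases i
  · exact congrFun h0 j
  · exact congrFun h1 j
  · change U 2 j = V 2 j
    rw [su3_row_two_eq_star_cross hU, su3_row_two_eq_star_cross hV, h0, h1]

end SpecialUnitaryThree

/-! ## §3 Reconstruction from an orthonormal pair lands in `SU(3)` -/

section Reconstruction

/-- The rows of the reconstructed matrix. -/
theorem reconstruct_rows (u v : Fin 3 → ℂ) :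
    (Matrix.of ![u, v, star (u ⨯₃ v)] : Matrix (Fin 3) (Fin 3) ℂ) 0 = u ∧
      (Matrix.of ![u, v, star (u ⨯₃ v)] : Matrix (Fin 3) (Fin 3) ℂ) 1 = v ∧
      (Matrix.of ![u, v, star (u ⨯₃ v)] : Matrix (Fin 3) (Fin 3) ℂ) 2 = star (u ⨯₃ v) := by
  refine ⟨?_, ?_, ?_⟩ <;> rfl

/-- Lagrange's identity in the Hermitian form: `conj(u × v) ⬝ (u × v) = (u⬝ū)(v⬝v̄) − (u⬝v̄)(v⬝ū)`. -/
theorem star_cross_dot_cross (u v : Fin 3 → ℂ) :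
    star (u ⨯₃ v) ⬝ᵥ (u ⨯₃ v) =
      (u ⬝ᵥ star u) * (v ⬝ᵥ star v) - (u ⬝ᵥ star v) * (v ⬝ᵥ star u) := by
  rw [dotProduct_comm, star_cross, cross_dot_cross]

/-- **The reconstructed matrix `[u; v; conj(u × v)]` is special unitary** whenever `u, v` are
Hermitian-orthonormal (`u ⬝ ū = v ⬝ v̄ = 1`, `u ⬝ v̄ = 0`). -/
theorem reconstruct_mem_specialUnitaryGroup {u v : Fin 3 → ℂ} (hu : u ⬝ᵥ star u = 1)
    (hv : v ⬝ᵥ star v = 1) (huv : u ⬝ᵥ star v = 0) :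
    (Matrix.of ![u, v, star (u ⨯₃ v)] : Matrix (Fin 3) (Fin 3) ℂ) ∈
      Matrix.specialUnitaryGroup (Fin 3) ℂ := by
  set w : Fin 3 → ℂ := star (u ⨯₃ v) with hw
  set M : Matrix (Fin 3) (Fin 3) ℂ := Matrix.of ![u, v, w] with hM
  have hvu : v ⬝ᵥ star u = 0 := by rw [dotProduct_star, huv, star_zero]
  -- the pairwise Hermitian products of the rows
  have hww : w ⬝ᵥ star w = 1 := by
    rw [hw, star_star, star_cross_dot_cross, hu, hv, huv, hvu]; ring
  have huw : u ⬝ᵥ star w = 0 := by rw [hw, star_star]; exact dot_self_cross u v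
  have hvw : v ⬝ᵥ star w = 0 := by rw [hw, star_star]; exact dot_cross_self u v
  have hwu : w ⬝ᵥ star u = 0 := by rw [dotProduct_star, huw, star_zero]
  have hwv : w ⬝ᵥ star v = 0 := by rw [dotProduct_star, hvw, star_zero]
  -- rows of `M`
  have r0 : M 0 = u := rfl
  have r1 : M 1 = v := rfl
  have r2 : M 2 = w := rfl
  have hmul : ∀ i j, (M * star M) i j = M i ⬝ᵥ star (M j) := by
    intro i j
    rw [Matrix.mul_apply', star_eq_conjTranspose]
    rfl
  have hunit : M ∈ Matrix.unitaryGroup (Fin 3) ℂ := by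
    rw [Matrix.mem_unitaryGroup_iff]
    ext i j
    rw [hmul]
    fin_cases i <;> fin_cases j <;>
      simp only [Fin.zero_eta, Fin.mk_one, Fin.isValue, Fin.reduceFinMk, r0, r1, r2, hu, hv, hww,
        huv, hvu, huw, hvw, hwu, hwv, Matrix.one_apply_eq] <;> rfl
  refine Matrix.mem_specialUnitaryGroup_iff.mpr ⟨hunit, ?_⟩
  -- `det M = w ⬝ (u × v) = conj(u × v) ⬝ (u × v) = 1`
  have hdet : M.det = w ⬝ᵥ (u ⨯₃ v) := by
    change Matrix.det (![u, v, w] : Matrix (Fin 3) (Fin 3) ℂ) = _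
    rw [← triple_product_eq_det, triple_product_permutation u v w, triple_product_permutation v w u]
  rw [hdet, hw, star_cross_dot_cross, hu, hv, huv, hvu]
  ring

end Reconstruction

end Summit.Ventures.LatticeQCDFlow.Scoring
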